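import Literature.Probability.LatticeModels.KCTwoPointNice
import Literature.Probability.LatticeModels.KCGaugedDifference
import Literature.Probability.LatticeModels.KCSeamSectionPrimitive
import Literature.Probability.LatticeModels.KCLayerBoundKC
import Literature.Probability.LatticeModels.KilledWalkWeakBeurling
import HarnessLib

/-!
# The gauged difference of the two-point family is a seam section near the source

Topic `Literature/Probability/LatticeModels`. Chelkak–Hongler–Izyurov 2015, Lemma 3.5 / Remark 3.8 /
Remark 3.9 for the two-point family `F_{[Ω_δ,a;b]}` (`KCTwoPointFamily.lean`): in the chart near the
source `a` whose gauge is `σ = twoPointGauge a b false (nearT a b)` (the side `nearT a b` of the second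
marked point being chosen so that the seam ray of `b` removed by the chart does not pass through `a`),
the gauged difference

`D_δ = χ_σ F_{[Ω_δ,a;b]} - S₀'(δ) · χ F_{[ℂ_δ,a]}`   (`kcDiffG`, `srcMag`, `KCGaugedDifference.lean`)

has, at every corner of a lattice box around `â = nearestSite δ a` free of the influence of `b`, the
table of a SEAM SECTION (`IsSeamSection`, `KCSeamSectionPrimitive.lean`): compatible with
`seamSign p₀` everywhere and, at the source corner, BOTH s-holomorphic and anti. Ingredients: the table
of the spin fermion (`compatAt_kcObs`, `KCLayerBoundKC.lean`), the lower-corner signs with one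
background spin (`lowSigns_eq`), the gauge bookkeeping (`compatAt_rowGauge_upper/lower`), the table of
the explicit spinor (`SlitPlaneSeamMatching.lean`) and Lemma 3.5 at the source corner
(`isSHolAt_kcDiffG_source`, `isAntiAt_kcDiffG_source`, whose source gauge condition is verified here).

* `nearT`, `not_mem_rowRay_nearT`, `srcGaugeTP`;
* `compatAt_rowGauge_upper`, `compatAt_rowGauge_lower`, `CompatAt.sub_smul`, `compatAt_slitFCg`;
* **`isSeamSection_twoPoint`** (fixed scale, lattice hypotheses) and **`eventually_isSeamSection_twoPoint`**.

Everything is proved; no named fact.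

## References

* D. Chelkak, C. Hongler, K. Izyurov, Ann. of Math. 181 (2015), Lemma 3.2, Lemma 3.5, Remark 3.8,
  Remark 3.9 [ChelkakHonglerIzyurovAnnals2015].
-/

noncomputable section

namespace Literature.Probability.LatticeModels

open Complex Filter Metric Set _root_.Topology Finset SimpleGraph WeakBeurling
open scoped symmDiff

variable {Ω : Set ℂ} {a b : ℂ}

/-! ### Gauge bookkeeping at the level of `CompatAt` -/

/-- `CompatAt F q 1 ↔ IsSHolAt F q`. [folklore] -/
theorem compatAt_one_iff {F : MedialVertex → ℂ} {q : Site 2 × Fin 4} : CompatAt F q 1 ↔ IsSHolAt F q := by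
  constructor
  · rintro (⟨-, h⟩ | ⟨h, -⟩)
    · exact h
    · norm_num at h
  · exact fun h => h.compatAt

/-- `CompatAt F q (-1) ↔ IsAntiAt F q`. [folklore] -/
theorem compatAt_neg_one_iff {F : MedialVertex → ℂ} {q : Site 2 × Fin 4} : CompatAt F q (-1) ↔ IsAntiAt F q := by
  constructor
  · rintro (⟨h, -⟩ | ⟨-, h⟩)
    · norm_num at h
    · exact h
  · exact fun h => h.compatAt

/-- **Equal bond signs at a corner do not change compatibility.** [folklore] -/
theorem compatAt_sign_mul_iff_of_eq {χ : MedialVertex → ℝ} {F : MedialVertex → ℂ} {q : Site 2 × Fin 4}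
    (hχ : χ (cSrc q) = 1 ∨ χ (cSrc q) = -1) (heq : χ (cTgt q) = χ (cSrc q)) {s : ℝ} :
    CompatAt (fun e => (χ e : ℂ) * F e) q s ↔ CompatAt F q s := by
  unfold CompatAt
  rw [isSHolAt_sign_mul_iff hχ heq, isAntiAt_sign_mul_iff hχ heq]

/-- **Opposite bond signs at a corner flip compatibility.** [folklore] -/
theorem compatAt_sign_mul_iff_of_opp {χ : MedialVertex → ℝ} {F : MedialVertex → ℂ} {q : Site 2 × Fin 4}
    (hχ : χ (cSrc q) = 1 ∨ χ (cSrc q) = -1) (hop : χ (cTgt q) = -χ (cSrc q)) {s : ℝ} (hs : s = 1 ∨ s = -1) :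
    CompatAt (fun e => (χ e : ℂ) * F e) q (-s) ↔ CompatAt F q s := by
  obtain ⟨h1, h2⟩ := isSHolAt_sign_mul_iff_anti (F := F) hχ hop
  rcases hs with rfl | rfl
  · rw [compatAt_neg_one_iff, compatAt_one_iff]; exact h2
  · rw [neg_neg, compatAt_one_iff, compatAt_neg_one_iff]; exact h1

/-- **The row gauge at the upper corners** (`NE`, `NW`): compatibility unchanged. [cite: ChelkakHonglerIzyurovAnnals2015, §3.2] -/
theorem compatAt_rowGauge_upper {σ : ℤ → ℝ} (hσ : ∀ r, σ r = 1 ∨ σ r = -1) (F : MedialVertex → ℂ) (y : Site 2)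
    {k : Fin 4} (hk : k = 0 ∨ k = 1) {s : ℝ} : CompatAt (rowGauge σ F) (y, k) s ↔ CompatAt F (y, k) s := by
  rw [show rowGauge σ F = fun e => (rowChi σ e : ℂ) * F e from rfl]
  rcases hk with rfl | rfl
  · obtain ⟨h1, h2⟩ := rowChi_corner_zero σ y
    exact compatAt_sign_mul_iff_of_eq (rowChi_cases hσ _) (h2.trans h1.symm)
  · obtain ⟨h1, h2⟩ := rowChi_corner_one σ y
    exact compatAt_sign_mul_iff_of_eq (rowChi_cases hσ _) (h2.trans h1.symm)

/-- **The row gauge at the lower corners** (`SW`, `SE`): compatibility is multiplied by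
`σ(y₁ - 1) σ(y₁)`. [cite: ChelkakHonglerIzyurovAnnals2015, §3.2] -/
theorem compatAt_rowGauge_lower {σ : ℤ → ℝ} (hσ : ∀ r, σ r = 1 ∨ σ r = -1) (F : MedialVertex → ℂ) (y : Site 2)
    {k : Fin 4} (hk : k = 2 ∨ k = 3) {s : ℝ} (hs : s = 1 ∨ s = -1) :
    CompatAt (rowGauge σ F) (y, k) (s * (σ (y 1 - 1) * σ (y 1))) ↔ CompatAt F (y, k) s := by
  rw [show rowGauge σ F = fun e => (rowChi σ e : ℂ) * F e from rfl]
  have hpm := pm_eq_of_mul_eq (hσ (y 1 - 1)) (hσ (y 1))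
  rcases hk with rfl | rfl
  · obtain ⟨h1, h2⟩ := rowChi_corner_two σ y
    rcases pm_mul (hσ (y 1 - 1)) (hσ (y 1)) with hp | hp <;> rw [hp]
    · rw [mul_one]
      exact compatAt_sign_mul_iff_of_eq (rowChi_cases hσ _) (by rw [h1, h2]; exact hpm.1 hp)
    · rw [mul_neg_one]
      exact compatAt_sign_mul_iff_of_opp (rowChi_cases hσ _) (by rw [h1, h2]; exact hpm.2 hp) hs
  · obtain ⟨h1, h2⟩ := rowChi_corner_three σ y
    rcases pm_mul (hσ (y 1 - 1)) (hσ (y 1)) with hp | hp <;> rw [hp]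
    · rw [mul_one]
      exact compatAt_sign_mul_iff_of_eq (rowChi_cases hσ _) (by rw [h1, h2]; exact (hpm.1 hp).symm)
    · rw [mul_neg_one]
      refine compatAt_sign_mul_iff_of_opp (rowChi_cases hσ _) (by rw [h1, h2, hpm.2 hp, neg_neg]) hs

/-- **Linearity**: compatibility with the same sign is preserved by `F - c • G`. [folklore] -/
theorem CompatAt.sub_smul {F G : MedialVertex → ℂ} {q : Site 2 × Fin 4} {s : ℝ} (c : ℝ) (hF : CompatAt F q s)
    (hG : CompatAt G q s) : CompatAt (fun e => F e - (c : ℂ) * G e) q s := by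
  rcases hF with ⟨rfl, hF⟩ | ⟨rfl, hF⟩
  · exact (isSHolAt_sub_smul c hF (compatAt_one_iff.1 hG)).compatAt
  · exact (anti_sub_smul c hF (compatAt_neg_one_iff.1 hG)).compatAt

/-- **The table of the gauged explicit spinor** off the source corner: compatible with `seamSign`. [cite: ChelkakHonglerIzyurovAnnals2015, Lemma 3.5 and Remark 3.9] -/
theorem compatAt_slitFCg (p₀ y : Site 2) (k : Fin 4) (h : ¬(y = p₀ + cornerUnit 0 + cornerUnit 1 ∧ k = 2)) :
    CompatAt (slitFCg p₀) (y, k) (seamSign p₀ (y, k)) := by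
  fin_cases k
  · show CompatAt _ (y, 0) (seamSign p₀ (y, 0))
    rw [seamSign_zero]; exact (isSHolAt_slitFCg_zero p₀ y).compatAt
  · show CompatAt _ (y, 1) (seamSign p₀ (y, 1))
    rw [seamSign_one]; exact (isSHolAt_slitFCg_one p₀ y).compatAt
  · show CompatAt _ (y, 2) (seamSign p₀ (y, 2))
    rw [seamSign_two]
    split_ifs with hs
    · exact (isAntiAt_slitFCg_two p₀ y hs.1 hs.2).compatAt
    · refine (isSHolAt_slitFCg_two p₀ y hs fun hsrc => h ⟨?_, rfl⟩).compatAt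
      ext i; fin_cases i
      · have := hsrc.1; simp only [srcI] at this; simp [Pi.add_apply]; omega
      · have := hsrc.2; simp only [srcJ] at this; simp [Pi.add_apply]; omega
  · show CompatAt _ (y, 3) (seamSign p₀ (y, 3))
    rw [seamSign_three]
    split_ifs with hs
    · exact (isAntiAt_slitFCg_three p₀ y hs.1 hs.2).compatAt
    · exact (isSHolAt_slitFCg_three p₀ y hs).compatAt

/-! ### The side of the second marked point and the gauge near the source -/

/-- **The side of `b` used near `a`**: `true` (chart removing the LEFTWARD ray of `b`) exactly when `b`
lies on the horizontal through `a`, weakly to its left. [folklore] -/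
def nearT (a b : ℂ) : Bool := decide (a.im = b.im ∧ b.re ≤ a.re)

/-- The removed ray of `b` misses `a`. [folklore] -/
theorem not_mem_rowRay_nearT (hab : a ≠ b) : a ∉ rowRay b (nearT a b) := by
  unfold nearT rowRay
  by_cases h : a.im = b.im ∧ b.re ≤ a.re
  · rw [decide_eq_true h]
    rintro ⟨h1, h2⟩
    simp only [ite_true] at h2
    exact hab (Complex.ext (le_antisymm h2 h.2) h.1)
  · rw [decide_eq_false h]
    rintro ⟨h1, h2⟩
    simp only [Bool.false_eq_true, ite_false] at h2
    exact h ⟨h1, h2⟩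

variable (a b) in
/-- **The gauge near the source**: `twoPointGauge a b false (nearT a b)`. [cite: ChelkakHonglerIzyurovAnnals2015, §3.2] -/
def srcGaugeTP (δ : ℝ) : ℤ → ℝ := twoPointGauge a b false (nearT a b) δ

/-- The gauge near the source is `±1`. [folklore] -/
theorem srcGaugeTP_pm (δ : ℝ) (r : ℤ) : srcGaugeTP a b δ r = 1 ∨ srcGaugeTP a b δ r = -1 := twoPointGauge_pm a b _ _ δ r

/-- The gauge near the source, unfolded. [folklore] -/
theorem srcGaugeTP_apply (δ : ℝ) (r : ℤ) :
    srcGaugeTP a b δ r = if nearT a b then rowFlip (nearestSite δ b 1) r else 1 := by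
  unfold srcGaugeTP twoPointGauge
  simp

/-- The consecutive-row product of the gauge near the source. [folklore] -/
theorem srcGaugeTP_pred_mul_self (δ : ℝ) (r : ℤ) :
    srcGaugeTP a b δ (r - 1) * srcGaugeTP a b δ r = if (nearT a b = true ∧ r = nearestSite δ b 1) then -1 else 1 := by
  rw [srcGaugeTP_apply, srcGaugeTP_apply]
  cases nearT a b
  · simp
  · simp only [ite_true, true_and]
    exact rowFlip_pred_mul_self _ _

/-! ### The seam section at a fixed scale -/

variable (Ω a b) in
/-- **The gauged difference of the two-point family near the source** at mesh `δ`. [cite: ChelkakHonglerIzyurovAnnals2015, Lemma 3.5 and Remark 3.9] -/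
def twoPointDiff (δ : ℝ) : MedialVertex → ℂ :=
  kcDiffG (discreteDomainGraph Ω δ) (srcGaugeTP a b δ) (compVol Ω a δ) 1 {nearestSite δ b} ((twoPointFamily Ω a b).cut δ)
    (sourcePlaq δ a) (srcMag (discreteDomainGraph Ω δ) (srcGaugeTP a b δ) (compVol Ω a δ) 1 {nearestSite δ b} (sourcePlaq δ a))

variable (Ω a b) in
/-- The signed source magnetisation of the two-point family in the source gauge. [cite: ChelkakHonglerIzyurovAnnals2015, Lemma 3.2] -/
def srcMagTP (δ : ℝ) : ℝ :=
  srcMag (discreteDomainGraph Ω δ) (srcGaugeTP a b δ) (compVol Ω a δ) 1 {nearestSite δ b} (sourcePlaq δ a)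

/-- `S₀'(δ)² = S₀(δ)²`. [folklore] -/
theorem srcMagTP_sq (δ : ℝ) : srcMagTP Ω a b δ ^ 2 = srcMag0 Ω a b δ ^ 2 := by
  rw [srcMagTP, srcMag_sq _ (srcGaugeTP_pm δ), srcMag0]

/-- Unfolding `twoPointDiff`. [folklore] -/
theorem twoPointDiff_eq (δ : ℝ) : twoPointDiff Ω a b δ = fun e =>
    rowGauge (srcGaugeTP a b δ) ((twoPointFamily Ω a b).obs Ω δ) e - (srcMagTP Ω a b δ : ℂ) * slitFCg (sourcePlaq δ a) e := rfl

/-- Coordinates of the source plaquette and of its corner `p₀ + e₁`. [folklore] -/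
theorem sourcePlaq_coords (δ : ℝ) (a : ℂ) :
    (sourcePlaq δ a) 0 = nearestSite δ a 0 - 1 ∧ (sourcePlaq δ a) 1 = nearestSite δ a 1 - 1 ∧
    (sourcePlaq δ a + cornerUnit 1) 0 = nearestSite δ a 0 - 1 ∧ (sourcePlaq δ a + cornerUnit 1) 1 = nearestSite δ a 1 ∧
    sourcePlaq δ a + cornerUnit 0 + cornerUnit 1 = nearestSite δ a ∧
    sourcePlaq δ a + cornerUnit 0 = nearestSite δ a + cornerUnit 3 := by
  obtain ⟨h0, h1⟩ := sourcePlaq_apply δ a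
  refine ⟨h0, h1, by simp [Pi.add_apply, h0], by simp [Pi.add_apply, h1], sourcePlaq_add_eq_nearestSite δ a, ?_⟩
  ext i; fin_cases i <;> (simp [Pi.add_apply, h0, h1, cornerUnit]; try ring)

/-- **The gauged difference of the two-point family is a seam section on a box around the source**, at a
good scale at which the box (enlarged by two) consists of free sites, the rows of the box see the
background spin `b̂` only through the gauge (`hfar`/`hleft`), and the rows of `a` and `b` agree when
`b` is on the horizontal of `a` to its left (`hrow`). [cite: ChelkakHonglerIzyurovAnnals2015, Lemma 3.5, Remark 3.8, Remark 3.9] -/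
theorem isSeamSection_twoPoint {δ : ℝ} (hgood : GoodScale Ω a δ) {R : ℕ}
    (hbox : ∀ y ∈ sqBox (nearestSite δ a) ((R : ℤ) + 2), y ∈ compVol Ω a δ)
    (hfar : nearT a b = false → ∀ y ∈ sqBox (nearestSite δ a) ((R : ℤ) + 1), y 1 = nearestSite δ b 1 → y 0 < nearestSite δ b 0)
    (hleft : nearT a b = true → ∀ y ∈ sqBox (nearestSite δ a) ((R : ℤ) + 1), nearestSite δ b 0 < y 0)
    (hrow : nearT a b = true → nearestSite δ a 1 = nearestSite δ b 1) :
    IsSeamSection (twoPointDiff Ω a b δ) (sourcePlaq δ a) {q | q.1 ∈ sqBox (nearestSite δ a) ((R : ℤ) + 1)} := by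
  classical
  have hσpm : ∀ r, srcGaugeTP a b δ r = 1 ∨ srcGaugeTP a b δ r = -1 := srcGaugeTP_pm δ
  obtain ⟨hcuts, h0, -, -, -⟩ := twoPointData_spec b hgood
  have hcd : (twoPointFamily Ω a b).cut δ = (twoPointData Ω a b δ).1 := rfl
  have hadj : ∀ v ∈ compVol Ω a δ, ∀ k : Fin 4, (discreteDomainGraph Ω δ).Adj v (v + cornerUnit k) :=
    fun v hv k => compVol_adj hv k
  have hle : discreteDomainGraph Ω δ ≤ zdGraph 2 := discreteDomainGraph_le_zdGraph Ω δ
  obtain ⟨c0, c1, c10, c11, hv₀, hu⟩ := sourcePlaq_coords δ a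
  have hahΛ : nearestSite δ a ∈ compVol Ω a δ := nearestSite_mem_compVol hgood.2
  have hp₀t : sourcePlaq δ a ∈ touchPlaquettes (compVol Ω a δ) := by
    rw [sourcePlaq_eq_faceAt]; exact faceAt_mem_touchPlaquettes hahΛ 2
  -- box bookkeeping
  have hbox1 : ∀ y ∈ sqBox (nearestSite δ a) ((R : ℤ) + 1),
      y ∈ compVol Ω a δ ∧ y + cornerUnit 2 ∈ compVol Ω a δ ∧ y + cornerUnit 3 ∈ compVol Ω a δ := by
    intro y hy
    rw [mem_sqBox] at hy
    refine ⟨hbox y ?_, hbox _ ?_, hbox _ ?_⟩ <;> rw [mem_sqBox] <;> simp only [Pi.add_apply, cornerUnit, abs_le] at hy ⊢ <;>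
      constructor <;> simp <;> omega
  have hP : ∀ y ∈ compVol Ω a δ, ∀ k : Fin 4, faceAt y k ∈ (↑(fillFinset (touchPlaquettes (compVol Ω a δ))) : Set (Site 2)) :=
    fun y hy k => Finset.mem_coe.2 (subset_fillFinset _ (faceAt_mem_touchPlaquettes hy k))
  -- the sign dictionary on the box
  have hsigns : ∀ y ∈ sqBox (nearestSite δ a) ((R : ℤ) + 1),
      siteSign {nearestSite δ b} (twoPointData Ω a b δ).1 y 2 * (srcGaugeTP a b δ (y 1 - 1) * srcGaugeTP a b δ (y 1)) =
        (if srcJ (sourcePlaq δ a) y = 0 ∧ 0 ≤ srcI (sourcePlaq δ a) y then -1 else 1) ∧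
      siteSign {nearestSite δ b} (twoPointData Ω a b δ).1 y 3 * (srcGaugeTP a b δ (y 1 - 1) * srcGaugeTP a b δ (y 1)) =
        (if srcJ (sourcePlaq δ a) y = 0 ∧ 0 ≤ srcI (sourcePlaq δ a) y then -1 else 1) := by
    intro y hy
    obtain ⟨-, -, hyS⟩ := hbox1 y hy
    obtain ⟨e2, e3⟩ := lowSigns_eq (Ω := Ω) (δ := δ) compVol_subset compVol_preconnected hcuts hp₀t h0 (nearestSite δ b) hyS
    obtain ⟨-, -, s2, s3⟩ := siteSign_apply {nearestSite δ b} (twoPointData Ω a b δ).1 y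
    have hsrc : ((sourcePlaq δ a) 1 = y 1 - 1 ∧ (sourcePlaq δ a) 0 < y 0) ↔ (srcJ (sourcePlaq δ a) y = 0 ∧ 0 ≤ srcI (sourcePlaq δ a) y) := by
      simp only [srcJ, srcI]; omega
    have hg : srcGaugeTP a b δ (y 1 - 1) * srcGaugeTP a b δ (y 1) = (if y 1 = nearestSite δ b 1 ∧ nearestSite δ b 0 < y 0 then -1 else 1) ∧
        srcGaugeTP a b δ (y 1 - 1) * srcGaugeTP a b δ (y 1) = (if y 1 = nearestSite δ b 1 ∧ nearestSite δ b 0 ≤ y 0 then -1 else 1) := by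
      rw [srcGaugeTP_pred_mul_self]
      cases ht : nearT a b
      · have h1 := hfar ht y hy
        simp only [Bool.false_eq_true, false_and, ite_false]
        constructor
        · rw [if_neg]; rintro ⟨h2, h3⟩; have := h1 h2; omega
        · rw [if_neg]; rintro ⟨h2, h3⟩; have := h1 h2; omega
      · have h1 := hleft ht y hy
        simp [h1, h1.le]
    rw [s2, s3, e2, e3]
    have hsrc' : (if (sourcePlaq δ a) 1 = y 1 - 1 ∧ (sourcePlaq δ a) 0 < y 0 then (-1 : ℝ) else 1) =
        (if srcJ (sourcePlaq δ a) y = 0 ∧ 0 ≤ srcI (sourcePlaq δ a) y then -1 else 1) := by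
      by_cases h : (sourcePlaq δ a) 1 = y 1 - 1 ∧ (sourcePlaq δ a) 0 < y 0
      · rw [if_pos h, if_pos (hsrc.1 h)]
      · rw [if_neg h, if_neg (fun h' => h (hsrc.2 h'))]
    constructor
    · rw [hg.1, hsrc']; split_ifs <;> norm_num
    · rw [hg.2, hsrc']; split_ifs <;> norm_num
  -- the source gauge condition
  have hsrcg : srcGaugeTP a b δ ((sourcePlaq δ a) 1 + 1) * hLowSign {nearestSite δ b} (sourcePlaq δ a + cornerUnit 1) =
      -(srcGaugeTP a b δ ((sourcePlaq δ a) 1) * rowSign {nearestSite δ b} ((sourcePlaq δ a) 1)) := by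
    have hmem : sourcePlaq δ a + cornerUnit 1 ∈ sqBox (nearestSite δ a) ((R : ℤ) + 1) := by
      rw [mem_sqBox, c10, c11]; constructor
      · simp
      · simp; omega
    have hL : hLowSign {nearestSite δ b} (sourcePlaq δ a + cornerUnit 1) =
        -(-1) ^ (if nearestSite δ a 1 = nearestSite δ b 1 ∧ nearestSite δ a 0 - 1 < nearestSite δ b 0 then 1 else 0) *
          (if nearestSite δ b 1 ≤ nearestSite δ a 1 then -1 else 1) := by
      rw [hLowSign, rayCountB_singleton_east, rowSign_singleton, c10, c11]
    have hRw : rowSign {nearestSite δ b} ((sourcePlaq δ a) 1) = if nearestSite δ b 1 ≤ nearestSite δ a 1 - 1 then -1 else 1 := by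
      rw [rowSign_singleton, c1]
    rw [hL, hRw, c1, sub_add_cancel, srcGaugeTP_apply, srcGaugeTP_apply]
    cases ht : nearT a b
    · have h1 := hfar ht _ hmem
      rw [c11, c10] at h1
      simp only [Bool.false_eq_true, ite_false, one_mul]
      by_cases hr : nearestSite δ a 1 = nearestSite δ b 1
      · have h2 : nearestSite δ a 0 - 1 < nearestSite δ b 0 := h1 hr
        have h3 : nearestSite δ b 1 ≤ nearestSite δ a 1 := hr.symm.le
        have h4 : ¬(nearestSite δ b 1 ≤ nearestSite δ a 1 - 1) := by omega
        rw [if_pos ⟨hr, h2⟩, if_pos h3, if_neg h4]; norm_num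
      · rw [if_neg (fun h => hr h.1)]
        by_cases h4 : nearestSite δ b 1 ≤ nearestSite δ a 1
        · have h5 : nearestSite δ b 1 ≤ nearestSite δ a 1 - 1 := by omega
          rw [if_pos h4, if_pos h5]; norm_num
        · have h5 : ¬(nearestSite δ b 1 ≤ nearestSite δ a 1 - 1) := by omega
          rw [if_neg h4, if_neg h5]; norm_num
    · have h1 := hleft ht _ hmem
      have h2 := hrow ht
      rw [c10] at h1
      simp only [ite_true, rowFlip]
      have h3 : ¬(nearestSite δ a 1 = nearestSite δ b 1 ∧ nearestSite δ a 0 - 1 < nearestSite δ b 0) := fun h => by omega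
      have h4 : ¬(nearestSite δ a 1 < nearestSite δ b 1) := by omega
      have h5 : nearestSite δ a 1 - 1 < nearestSite δ b 1 := by omega
      have h6 : nearestSite δ b 1 ≤ nearestSite δ a 1 := by omega
      have h7 : ¬(nearestSite δ b 1 ≤ nearestSite δ a 1 - 1) := by omega
      rw [if_neg h3, if_neg h4, if_pos h5, if_pos h6, if_neg h7]; norm_num
  -- the source corner
  have hsrc_shol : IsSHolAt (twoPointDiff Ω a b δ) (sourcePlaq δ a + cornerUnit 0 + cornerUnit 1, 2) ∧
      IsAntiAt (twoPointDiff Ω a b δ) (sourcePlaq δ a + cornerUnit 0 + cornerUnit 1, 2) := by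
    have huΛ : sourcePlaq δ a + cornerUnit 0 ∈ compVol Ω a δ := by
      rw [hu]
      exact (hbox1 (nearestSite δ a) (by rw [mem_sqBox]; constructor <;> simp <;> omega)).2.2
    have hf1 : faceAt (sourcePlaq δ a + cornerUnit 0) 1 ∈ (↑(fillFinset (touchPlaquettes (compVol Ω a δ))) : Set (Site 2)) :=
      hP _ huΛ 1
    have hf0 : faceAt (sourcePlaq δ a + cornerUnit 0) (1 + 3) ∈ (↑(fillFinset (touchPlaquettes (compVol Ω a δ))) : Set (Site 2)) := by
      rw [show (1 : Fin 4) + 3 = 0 from rfl]; exact hP _ huΛ 0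
    obtain ⟨he, hstep⟩ := hcuts.step_gaugeEquiv (discreteDomainGraph Ω δ) huΛ 1 hf1 hf0
    rw [show (1 : Fin 4) + 3 = 0 from rfl] at hstep
    simp only [cSrc] at he hstep
    exact ⟨isSHolAt_kcDiffG_source _ hadj hle _ h0 he hstep _ hsrcg, isAntiAt_kcDiffG_source _ hadj hle _ h0 he hstep _ hsrcg⟩
  refine ⟨fun q hq => ?_, hsrc_shol.2.compatAt⟩
  obtain ⟨y, k⟩ := q
  have hy : y ∈ sqBox (nearestSite δ a) ((R : ℤ) + 1) := hq
  obtain ⟨hyΛ, hyW, hyS⟩ := hbox1 y hy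
  by_cases hsc : y = sourcePlaq δ a + cornerUnit 0 + cornerUnit 1 ∧ k = 2
  · obtain ⟨rfl, rfl⟩ := hsc
    rw [seamSign_two, if_neg (by simp [srcI, Pi.add_apply])]
    exact hsrc_shol.1.compatAt
  -- off the source corner: spin fermion table, gauge, explicit spinor, linearity
  have hobs : CompatAt ((twoPointFamily Ω a b).obs Ω δ) (y, k) (siteSign {nearestSite δ b} (twoPointData Ω a b δ).1 y k) :=
    compatAt_kcObs (discreteDomainGraph Ω δ) hcuts hadj hle hyΛ hyW hyS (hP y hyΛ) k
  have hslit := compatAt_slitFCg (sourcePlaq δ a) y k hsc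
  rw [twoPointDiff_eq]
  refine CompatAt.sub_smul _ ?_ hslit
  obtain ⟨e0, e1, e2, e3⟩ := siteSign_apply {nearestSite δ b} (twoPointData Ω a b δ).1 y
  have hspm2 : siteSign {nearestSite δ b} (twoPointData Ω a b δ).1 y 2 = 1 ∨ siteSign {nearestSite δ b} (twoPointData Ω a b δ).1 y 2 = -1 := by
    rw [e2]; exact pm_mul (hLowSign_cases _ _) (vLowSign_cases _ _ _)
  have hspm3 : siteSign {nearestSite δ b} (twoPointData Ω a b δ).1 y 3 = 1 ∨ siteSign {nearestSite δ b} (twoPointData Ω a b δ).1 y 3 = -1 := by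
    rw [e3]; exact pm_mul (vLowSign_cases _ _ _) (hLowSign_cases _ _)
  fin_cases k
  · show CompatAt _ (y, 0) (seamSign (sourcePlaq δ a) (y, 0))
    rw [seamSign_zero]
    rw [show siteSign {nearestSite δ b} (twoPointData Ω a b δ).1 y ⟨0, _⟩ = siteSign {nearestSite δ b} (twoPointData Ω a b δ).1 y 0
      from rfl, e0] at hobs
    exact (compatAt_rowGauge_upper hσpm _ y (Or.inl rfl)).2 hobs
  · show CompatAt _ (y, 1) (seamSign (sourcePlaq δ a) (y, 1))
    rw [seamSign_one]
    rw [show siteSign {nearestSite δ b} (twoPointData Ω a b δ).1 y ⟨1, _⟩ = siteSign {nearestSite δ b} (twoPointData Ω a b δ).1 y 1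
      from rfl, e1] at hobs
    exact (compatAt_rowGauge_upper hσpm _ y (Or.inr rfl)).2 hobs
  · show CompatAt _ (y, 2) (seamSign (sourcePlaq δ a) (y, 2))
    have key := (compatAt_rowGauge_lower hσpm ((twoPointFamily Ω a b).obs Ω δ) y (Or.inl rfl) hspm2).2 hobs
    rw [(hsigns y hy).1] at key
    have hne : ¬(srcI (sourcePlaq δ a) y = 0 ∧ srcJ (sourcePlaq δ a) y = 0) := by
      rintro ⟨h1, h2⟩
      refine hsc ⟨?_, rfl⟩
      ext i; fin_cases i
      · simp only [srcI] at h1; simp [Pi.add_apply]; omega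
      · simp only [srcJ] at h2; simp [Pi.add_apply]; omega
    have hif : (if srcJ (sourcePlaq δ a) y = 0 ∧ 1 ≤ srcI (sourcePlaq δ a) y then (-1 : ℝ) else 1) =
        (if srcJ (sourcePlaq δ a) y = 0 ∧ 0 ≤ srcI (sourcePlaq δ a) y then -1 else 1) := by
      by_cases hJ : srcJ (sourcePlaq δ a) y = 0
      · have hI : srcI (sourcePlaq δ a) y ≠ 0 := fun hI => hne ⟨hI, hJ⟩
        by_cases h1 : 1 ≤ srcI (sourcePlaq δ a) y
        · rw [if_pos ⟨hJ, h1⟩, if_pos ⟨hJ, by omega⟩]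
        · rw [if_neg (fun h => h1 h.2), if_neg (fun h => by omega)]
      · rw [if_neg (fun h => hJ h.1), if_neg (fun h => hJ h.1)]
    rw [seamSign_two, hif]
    exact key
  · show CompatAt _ (y, 3) (seamSign (sourcePlaq δ a) (y, 3))
    have key := (compatAt_rowGauge_lower hσpm ((twoPointFamily Ω a b).obs Ω δ) y (Or.inr rfl) hspm3).2 hobs
    rw [(hsigns y hy).2] at key
    rw [seamSign_three]
    exact key

/-! ### The geometric hypotheses hold eventually -/

/-- Rounding: `δ (ẑ'₀ - ẑ₀) ≥ (Re z' - Re z) - 2δ`. [folklore] -/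
theorem sub_nearestSite_zero_ge {δ : ℝ} (hδ : 0 < δ) (z z' : ℂ) :
    (z'.re - z.re) - 2 * δ ≤ δ * ((nearestSite δ z' 0 : ℝ) - (nearestSite δ z 0 : ℝ)) := by
  have hz := dist_meshPoint_nearestSite_le hδ z
  have hz' := dist_meshPoint_nearestSite_le hδ z'
  rw [Complex.dist_eq] at hz hz'
  have e1 := abs_re_le_norm (meshPoint δ (nearestSite δ z) - z)
  have e2 := abs_re_le_norm (meshPoint δ (nearestSite δ z') - z')
  rw [Complex.sub_re, meshPoint_re] at e1 e2
  rw [abs_le] at e1 e2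
  nlinarith [e1.1, e1.2, e2.1, e2.2]

/-- Rounding: `δ |ẑ'₁ - ẑ₁| ≥ |Im z' - Im z| - 2δ`. [folklore] -/
theorem abs_sub_nearestSite_one_ge {δ : ℝ} (hδ : 0 < δ) (z z' : ℂ) :
    |z'.im - z.im| - 2 * δ ≤ δ * |(nearestSite δ z' 1 : ℝ) - (nearestSite δ z 1 : ℝ)| := by
  have hz := dist_meshPoint_nearestSite_le hδ z
  have hz' := dist_meshPoint_nearestSite_le hδ z'
  rw [Complex.dist_eq] at hz hz'
  have e1 := abs_im_le_norm (meshPoint δ (nearestSite δ z) - z)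
  have e2 := abs_im_le_norm (meshPoint δ (nearestSite δ z') - z')
  rw [Complex.sub_im, meshPoint_im] at e1 e2
  rw [← abs_of_pos hδ, ← abs_mul, abs_of_pos hδ, mul_sub]
  have h3 : |z'.im - z.im| ≤ |δ * (nearestSite δ z' 1 : ℝ) - δ * (nearestSite δ z 1 : ℝ)| +
      (|δ * (nearestSite δ z' 1 : ℝ) - z'.im| + |δ * (nearestSite δ z 1 : ℝ) - z.im|) := by
    calc |z'.im - z.im| = |(δ * (nearestSite δ z' 1 : ℝ) - δ * (nearestSite δ z 1 : ℝ)) +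
          (-(δ * (nearestSite δ z' 1 : ℝ) - z'.im) + (δ * (nearestSite δ z 1 : ℝ) - z.im))| := by congr 1; ring
      _ ≤ |δ * (nearestSite δ z' 1 : ℝ) - δ * (nearestSite δ z 1 : ℝ)| +
          |-(δ * (nearestSite δ z' 1 : ℝ) - z'.im) + (δ * (nearestSite δ z 1 : ℝ) - z.im)| := abs_add_le _ _
      _ ≤ _ := by
          gcongr
          exact (abs_add_le _ _).trans (by rw [abs_neg])
  linarith [hz'.trans' e2, hz.trans' e1]

/-- Equal ordinates have equal nearest rows. [folklore] -/
theorem nearestSite_one_eq_of_im_eq (δ : ℝ) {z z' : ℂ} (h : z.im = z'.im) : nearestSite δ z 1 = nearestSite δ z' 1 := by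
  simp [nearestSite, h]

variable (a b) in
/-- The separation of the two marked points seen along the relevant axis: the difference of ordinates,
or of abscissae when the ordinates agree. [folklore] -/
def markedSep : ℝ := if a.im = b.im then |a.re - b.re| else |a.im - b.im|

/-- The separation is positive for distinct points. [folklore] -/
theorem markedSep_pos (hab : a ≠ b) : 0 < markedSep a b := by
  unfold markedSep
  split_ifs with h
  · refine abs_pos.2 (sub_ne_zero.2 fun h' => hab (Complex.ext h' h))
  · exact abs_pos.2 (sub_ne_zero.2 h)

/-- **The gauged difference is a seam section on the box of Euclidean size `r` around the source, for
every small `r`, eventually along the mesh.** [cite: ChelkakHonglerIzyurovAnnals2015, Lemma 3.5, Remark 3.8, Remark 3.9] -/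
theorem eventually_isSeamSection_twoPoint (hΩo : IsOpen Ω) (hΩc : IsConnected Ω) (hM : MeshApproximates Ω) (ha : a ∈ Ω)
    (hab : a ≠ b) (hHF : ∀ᶠ δ in 𝓝[>] (0 : ℝ), HoleFree (↑(meshInteriorFinset Ω δ) : Set (Site 2))) :
    ∃ rmax > 0, ∀ r : ℝ, 0 < r → r ≤ rmax → ∀ᶠ δ in 𝓝[>] (0 : ℝ),
      (∀ y ∈ sqBox (nearestSite δ a) ((refRadius r δ : ℤ) + 2), y ∈ compVol Ω a δ) ∧
      IsSeamSection (twoPointDiff Ω a b δ) (sourcePlaq δ a) {q | q.1 ∈ sqBox (nearestSite δ a) ((refRadius r δ : ℤ) + 1)} := by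
  obtain ⟨ρ, hρ, hρΩ⟩ := Metric.isOpen_iff.1 hΩo a ha
  have hball : closedBall a (ρ / 2) ⊆ Ω := fun z hz => hρΩ (mem_ball.2 (lt_of_le_of_lt (mem_closedBall.1 hz) (by linarith)))
  have hd := markedSep_pos hab
  refine ⟨min (ρ / 8) (markedSep a b / 4), by positivity, fun r hr hrle => ?_⟩
  have hrρ : r ≤ ρ / 8 := hrle.trans (min_le_left _ _)
  have hrd : r ≤ markedSep a b / 4 := hrle.trans (min_le_right _ _)
  have hδev : ∀ᶠ δ in 𝓝[>] (0 : ℝ), δ ≤ min (ρ / 28) (markedSep a b / 8) :=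
    mem_nhdsWithin_of_mem_nhds (Iic_mem_nhds (by positivity))
  filter_upwards [eventually_goodScale hΩo hM ha hHF, eventually_ball_subset_compVol hΩo hΩc hM ha hball, hδev,
    self_mem_nhdsWithin] with δ hgood hbulk hδm hδ0
  have hδ0 : (0 : ℝ) < δ := hδ0
  have hδρ : δ ≤ ρ / 28 := hδm.trans (min_le_left _ _)
  have hδd : δ ≤ markedSep a b / 8 := hδm.trans (min_le_right _ _)
  obtain ⟨-, hR⟩ := refRadius_mul_bounds hr.le hδ0
  set R := refRadius r δ with hRdef
  -- the box of free sites
  have hbox : ∀ y ∈ sqBox (nearestSite δ a) ((R : ℤ) + 2), y ∈ compVol Ω a δ := by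
    intro y hy
    refine hbulk y ?_
    have h1 := dist_meshPoint_le_of_mem_sqBox hδ0.le hy
    have h2 := dist_meshPoint_nearestSite_le hδ0 a
    push_cast at h1
    calc dist (meshPoint δ y) a ≤ dist (meshPoint δ y) (meshPoint δ (nearestSite δ a)) + dist (meshPoint δ (nearestSite δ a)) a :=
          dist_triangle _ _ _
      _ ≤ δ * (2 * ((R : ℝ) + 2)) + δ := add_le_add h1 h2
      _ = 2 * ((R : ℝ) * δ) + 5 * δ := by ring
      _ ≤ ρ / 2 := by nlinarith
  refine ⟨hbox, isSeamSection_twoPoint hgood hbox (fun ht y hy hy1 => ?_) (fun ht y hy => ?_) (fun ht => ?_)⟩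
  · -- `nearT = false`: `Im a ≠ Im b`, or `Im a = Im b` and `Re a < Re b`
    have ht' : ¬(a.im = b.im ∧ b.re ≤ a.re) := by simpa [nearT] using ht
    rw [mem_sqBox] at hy
    have key : (R : ℝ) * δ + 2 * δ < markedSep a b - 2 * δ := by linarith
    by_cases him : a.im = b.im
    · have hre : a.re < b.re := by
        by_contra h; exact ht' ⟨him, not_lt.1 h⟩
      have hsep : markedSep a b = b.re - a.re := by
        rw [markedSep, if_pos him, abs_sub_comm, abs_of_pos (sub_pos.2 hre)]
      have h1 := sub_nearestSite_zero_ge hδ0 a b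
      rw [← hsep] at h1
      have h2 : (R : ℝ) + 2 < (nearestSite δ b 0 : ℝ) - (nearestSite δ a 0 : ℝ) := by
        by_contra h3
        push Not at h3
        nlinarith
      have h3 : (R : ℤ) + 2 < nearestSite δ b 0 - nearestSite δ a 0 := by exact_mod_cast h2
      have := (abs_le.1 hy.1).2
      omega
    · exfalso
      have hsep : markedSep a b = |a.im - b.im| := by rw [markedSep, if_neg him]
      have h1 := abs_sub_nearestSite_one_ge hδ0 a b
      rw [abs_sub_comm, ← hsep] at h1
      have h2 : (R : ℝ) + 2 < |(nearestSite δ b 1 : ℝ) - (nearestSite δ a 1 : ℝ)| := by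
        by_contra h3
        push Not at h3
        nlinarith [abs_nonneg ((nearestSite δ b 1 : ℝ) - (nearestSite δ a 1 : ℝ))]
      have h3 : (R : ℝ) + 2 < |((nearestSite δ b 1 - nearestSite δ a 1 : ℤ) : ℝ)| := by push_cast; exact h2
      rw [← Int.cast_abs] at h3
      have h4 : (R : ℤ) + 2 < |nearestSite δ b 1 - nearestSite δ a 1| := by exact_mod_cast h3
      have := (abs_le.1 hy.2).1
      have := (abs_le.1 hy.2).2
      rcases lt_abs.1 h4 with h4 | h4 <;> omega
  · -- `nearT = true`: `Im a = Im b` and `Re b < Re a`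
    have ht' : a.im = b.im ∧ b.re ≤ a.re := by simpa [nearT] using ht
    have hre : b.re < a.re := lt_of_le_of_ne ht'.2 fun h => hab (Complex.ext h.symm ht'.1)
    rw [mem_sqBox] at hy
    have key : (R : ℝ) * δ + 2 * δ < markedSep a b - 2 * δ := by linarith
    have hsep : markedSep a b = a.re - b.re := by
      rw [markedSep, if_pos ht'.1, abs_of_pos (sub_pos.2 hre)]
    have h1 := sub_nearestSite_zero_ge hδ0 b a
    rw [← hsep] at h1
    have h2 : (R : ℝ) + 2 < (nearestSite δ a 0 : ℝ) - (nearestSite δ b 0 : ℝ) := by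
      by_contra h3
      push Not at h3
      nlinarith
    have h3 : (R : ℤ) + 2 < nearestSite δ a 0 - nearestSite δ b 0 := by exact_mod_cast h2
    have := (abs_le.1 hy.1).1
    omega
  · have ht' : a.im = b.im ∧ b.re ≤ a.re := by simpa [nearT] using ht
    exact nearestSite_one_eq_of_im_eq δ ht'.1

end Literature.Probability.LatticeModels
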